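import Mathlib
import HarnessLib
import Summits.NavierStokesRegularity.NavierStokesRegularity.Theorems.PoloidalWindowDoorLrcModEntireWebPackageAnalytic

/-!
# Route `PoloidalWindowDoor`, item `LrcModEntire` (stmt-NavierStokesRegularity-20428), cell (Q4-sonic, straight, μ < 0) `stub_Q4sonicLineNeg`, case II —
# BRICK B-TWPc, ADD-ON: THE RIDGE CURVATURE `κt(τ,·)` IS `C^∞` IN THE HEIGHT (assembler convenience for `tower_kills_curvature`'s `hκ : ContDiffOn ℝ ∞ κ I`)

Cell ns-regularity-ideate, stub-worker seat ns-poloidal-K2-p2 g18 under the LEAD of item 20428 (ns-poloidal-K2-p3 g17/g18);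
`--supports stmt-NavierStokesRegularity-20428 --as helper`.  In the currency of the curved END (`δ′`-box package `hpack` of
`…CaseIIEntranceSharp.caseII_false_of_curvedEnd'`): the ridge curvature `κt(τ,z)` is, by the ridge law (conj 6 at the line parameter `s = 0`), minus the
horizontal trace of the Hessian of `F_τ = σ·U₂(−1+τ,·)` at the web point `frameCLM e (0, n₀(τ,0,z), z)`; the slice `F_τ` is `C^∞` (class) and the web function
`n₀` is `C^∞` (conj 5), so `z ↦ κt(τ,z)` is `C^∞` on `|z| < δ′` for every `|τ| < δ′`.

* ★ `ridgeCurvature_contDiffOn` — `ContDiffOn ℝ ∞ (κt τ) (Ioo (−δ′) δ′)` for `|τ| < δ′ (< 1/2)`.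

WHAT THIS IS NOT: not a claim about Navier–Stokes regularity; closes nothing; items 20428 / 19708 / 27893 OPEN (bears_on LADDER-NS N0).
-/

noncomputable section

set_option linter.dupNamespace false
set_option linter.style.longLine false

namespace Summit.NavierStokesRegularity.NavierStokesRegularity.Theorems.PoloidalWindowDoorLrcModEntireFermiTimeWebRidge

open Set Function Filter Topology Metric
open scoped RealInnerProductSpace InnerProductSpace ContDiff
open Literature.Analysis Literature.Analysis.FluidPDE Literature.Analysis.UnboundedOperators
open Summit.NavierStokesRegularity.NavierStokesRegularity.Theorems
open Summit.NavierStokesRegularity.NavierStokesRegularity.Theorems.PoloidalWindowDoorLrcModEntireSheetFlattenTools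
open Summit.NavierStokesRegularity.NavierStokesRegularity.Theorems.PoloidalWindowDoorLrcModEntireRidgeClassConstants

variable {C : ℝ} {U : ℝ → EuclideanSpace ℝ (Fin 3) → EuclideanSpace ℝ (Fin 3)}

/-- ★ **`z ↦ κt(τ,z)` is `C^∞` on `|z| < δ′`** (class data + `hpack` conj 5/6 only). -/
theorem ridgeCurvature_contDiffOn
    (hUrate : HasTypeITimeDecay C U) (hUcont : ContinuousOn (uncurry U) (Iio (0 : ℝ) ×ˢ univ))
    (hUmild : ∀ s t : ℝ, s < t → t < 0 → ∀ x, U t x = heatExtension (U s) (t - s) x - oseenDuhamel 1 s U U t x)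
    (hUdiv : ∀ t < 0, VectorCalculus.IsDivFree (U t))
    {σ : ℝ} {e : EuclideanSpace ℝ (Fin 3)} {δ' : ℝ} {n₀ : ℝ × ℝ × ℝ → ℝ} {κt : ℝ → ℝ → ℝ} (hδ'h : δ' < 1 / 2)
    (hC : ∀ q : ℝ × ℝ × ℝ, |q.1| < δ' → |q.2.2| < δ' → ∀ m : ℕ∞, ContDiffAt ℝ m n₀ q)
    (hridge : ∀ q : ℝ × ℝ × ℝ, |q.1| < δ' → |q.2.2| < δ' →
      fderiv ℝ (fderiv ℝ (fun y => σ * U (-1 + q.1) y 2)) (frameCLM e (q.2.1, n₀ q, q.2.2)) e e +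
          fderiv ℝ (fderiv ℝ (fun y => σ * U (-1 + q.1) y 2)) (frameCLM e (q.2.1, n₀ q, q.2.2)) (Jvec e) (Jvec e) =
        -κt q.1 q.2.2)
    {τ : ℝ} (hτ : |τ| < δ') : ContDiffOn ℝ ∞ (κt τ) (Ioo (-δ') δ') := by
  have ht : (-1 : ℝ) + τ < 0 := by linarith [(abs_lt.1 (lt_trans hτ hδ'h)).2]
  -- the slice is smooth, hence so is its Hessian as a map into bilinear forms
  have hF : ContDiff ℝ ∞ (fun y => σ * U (-1 + τ) y 2) := contDiff_signed_slice hUrate hUcont hUmild hUdiv ht σ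
  have hH : ContDiff ℝ ∞ (fderiv ℝ (fderiv ℝ (fun y => σ * U (-1 + τ) y 2))) :=
    (hF.fderiv_right (m := ∞) le_rfl).fderiv_right (m := ∞) le_rfl
  -- the web point at line parameter `0` is a smooth function of the height
  have hwpt : ContDiffOn ℝ ∞ (fun z : ℝ => frameCLM e ((0 : ℝ), n₀ (τ, 0, z), z)) (Ioo (-δ') δ') := by
    intro z hz
    have hz' : |z| < δ' := abs_lt.2 ⟨hz.1, hz.2⟩
    have hn : ContDiffAt ℝ ∞ (fun z' : ℝ => n₀ (τ, 0, z')) z :=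
      ((hC (τ, 0, z) hτ hz' (⊤ : ℕ∞)).comp z (contDiffAt_const.prodMk (contDiffAt_const.prodMk contDiffAt_id)) : )
    have h3 : ContDiffAt ℝ ∞ (fun z' : ℝ => (((0 : ℝ), n₀ (τ, 0, z'), z') : ℝ × ℝ × ℝ)) z :=
      contDiffAt_const.prodMk (hn.prodMk contDiffAt_id)
    exact ((frameCLM e).contDiff.contDiffAt.comp z h3).contDiffWithinAt
  have hK : ContDiffOn ℝ ∞ (fun z : ℝ => -(fderiv ℝ (fderiv ℝ (fun y => σ * U (-1 + τ) y 2)) (frameCLM e ((0 : ℝ), n₀ (τ, 0, z), z)) e e +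
      fderiv ℝ (fderiv ℝ (fun y => σ * U (-1 + τ) y 2)) (frameCLM e ((0 : ℝ), n₀ (τ, 0, z), z)) (Jvec e) (Jvec e))) (Ioo (-δ') δ') := by
    have hcomp : ContDiffOn ℝ ∞ (fun z : ℝ => fderiv ℝ (fderiv ℝ (fun y => σ * U (-1 + τ) y 2)) (frameCLM e ((0 : ℝ), n₀ (τ, 0, z), z))) (Ioo (-δ') δ') :=
      hH.comp_contDiffOn hwpt
    exact ((hcomp.clm_apply contDiffOn_const).clm_apply contDiffOn_const |>.add
      ((hcomp.clm_apply contDiffOn_const).clm_apply contDiffOn_const)).neg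
  refine hK.congr fun z hz => ?_
  have hz' : |z| < δ' := abs_lt.2 ⟨hz.1, hz.2⟩
  have h := hridge (τ, 0, z) hτ hz'
  simp only at h
  linarith

end Summit.NavierStokesRegularity.NavierStokesRegularity.Theorems.PoloidalWindowDoorLrcModEntireFermiTimeWebRidge

end
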